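import Summits.CriticalPhenomena.PercolationContinuityZ3.Theorems.PercNearOneGluingNoHeavyLowerTailSahiCombTriWShell

/-!
# `TRI_W(a) ≥ 0` on every PRINCIPAL up-set `P = {t | m ⊆ t}` — an unconditional stratum of `TriWIneq` for every index cube

Support file of the one-cut programme (crux `NoHeavyLowerTail`, stmt-CriticalPhenomena-4575; TRI lane of cell `prim-masterthm`;
seat prim-lf-1 gen 26, memo `FROM-prim-lf-1-gen26-PRINCIPAL-AND-NOGO.md` §1).

`FiveUpSet.TriWIneq` (`…SahiCombTriWGeneral`) asks for `0 ≤ triW P F G` for every up-set `P` of the cube `Finset γ` and all monotone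
families `F, G : Finset β → up-sets of Finset γ`.  Known strata constrain `F, G` (co-nested pairs, `F = G`, bottom-empty, …) or ask `P`
to contain its antipodal image (`triW_nonneg_of_refl_subset`, e.g. `P = univ`).  This file proves the inequality for every PRINCIPAL
up-set `P = {t | m ⊆ t}` (a face of the cube; in the Sahi / (M⁺⁺-3) dictionary: the third event is a cylinder
`{ω ⊇ m}`), for EVERY index cube `Finset β` and every cube `Finset γ`, with no further hypothesis:

* the face `{t | m ⊆ t}` (`univ.filter (m ⊆ ·)`) and its up-set property (`mem_principal`, `isUpperSet_principal`);
* `FiveUpSet.card_principal_inter_refl_le` — RELATIVE KLEITMAN LEMMA on the face: for up-sets `A, B`,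
  `#{t ⊇ m : t ∈ A, tᶜ ∈ B} ≤ #{t ⊇ m : t ∈ A, t \ m ∈ B}` (Kleitman's antipodal lemma applied to the up-set `{t | t \ m ∈ B}`, which has the
  same antipodal trace on the face);
* `FiveUpSet.card_principal_inter_refl_refl` — the INTERVAL ANTIPODE `t ↦ m ∪ tᶜ` of the face: `#{t ⊇ m : tᶜ ∈ A, tᶜ ∈ B} = #{t ⊇ m : t \ m ∈ A ∩ B}`;
* `FiveUpSet.principal_pointwise_nonneg` — the index-cube inequality `2#(f ∩ g) + #(q ∩ refl h) ≥ #(f ∩ refl h) + #(q ∩ refl g) + #(q ∩ h)` for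
  up-sets `q ⊆ f`, `h ⊆ g` of the index cube (Kleitman in the index cube: `#(f ∩ refl h) + #(q ∩ refl (g \ h)) ≤ #(f ∩ refl g) ≤ #(f ∩ g)`);
* **`FiveUpSet.triW_nonneg_of_principal`** — `0 ≤ triW (univ.filter (fun t : Finset γ => m ⊆ t)) F G` for all monotone families of up-sets, every `a = #β`, every `n`.
PROOF: in `triWTerm P F G x` bound the two mixed antipodal counts by the relative Kleitman lemma and rewrite the two doubly-antipodal counts
through the interval antipode; after double counting (`x ↔ t`) the lower bound is `Σ_{t ∈ P} E(t)` with `E(t)` the index-cube expression of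
`principal_pointwise_nonneg` for `f = {x | t ∈ F x}`, `g = {x | t ∈ G x}`, `q = {x | t \ m ∈ F x}`, `h = {x | t \ m ∈ G x}`.
(Equivalently: on the face, `TRI_W` equals the DECOUPLED functional of `…TriWCertificate` (families `Q x = {s | s ∈ F x} ⊆ F⁺ x = {s | m ∪ s ∈ F x}`)
at `P = univ` of the smaller cube `2^{γ \ m}`, and that functional is a sum of Kleitman gaps at `P = univ`.)
HONEST LABEL: one new unconditional stratum (condition on `P` alone) with an elementary proof; `TriWIneq` for general up-sets `P`
(already for `a = 2`) remains OPEN. [this work]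
-/

namespace Summit.CriticalPhenomena.PercolationContinuityZ3.Theorems

namespace FiveUpSet

open Finset

variable {β γ : Type} [DecidableEq β] [Fintype β] [DecidableEq γ] [Fintype γ]

/-! ### Principal up-sets (faces of the cube) -/

/-- Membership in the principal up-set (face) `{t | m ⊆ t}`, written `univ.filter (fun t => m ⊆ t)` throughout this file. [this work] -/
@[simp] theorem mem_principal (m t : Finset γ) : t ∈ (univ.filter (fun t => m ⊆ t) : Finset (Finset γ)) ↔ m ⊆ t := by
  simp

/-- A principal up-set is an up-set. [this work] -/
theorem isUpperSet_principal (m : Finset γ) : IsUpperSet ((univ.filter (fun t => m ⊆ t) : Finset (Finset γ)) : Set (Finset γ)) := by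
  intro s t hst hs
  rw [mem_coe, mem_principal] at hs ⊢
  exact hs.trans hst

/-- On the face `{t | m ⊆ t}` the complement misses `m`: `tᶜ \ m = tᶜ`. [this work] -/
theorem compl_sdiff_eq_of_subset {m t : Finset γ} (h : m ⊆ t) : tᶜ \ m = tᶜ :=
  Finset.sdiff_eq_self_iff_disjoint.2 (disjoint_compl_left.mono_right h)

/-! ### The relative Kleitman lemma on a face -/

/-- **Relative Kleitman lemma.**  For up-sets `A, B` and any `m`:
`#{t ⊇ m : t ∈ A, tᶜ ∈ B} ≤ #{t ⊇ m : t ∈ A, t \ m ∈ B}` — inside the face `{t ⊇ m}` (a cube of dimension `n − #m` with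
antipode `t ↦ m ∪ tᶜ`), the antipodal image of the up-set `{t | t \ m ∈ B}` is met by the up-set `A` no more often than the up-set itself.
Proof: for `t ⊇ m`, `tᶜ ∈ B ↔ tᶜ \ m ∈ B`, so the left side is `#((univ.filter (fun t : Finset γ => m ⊆ t) ∩ A) ∩ refl B')` with the up-set `B' = {t | t \ m ∈ B}`, and
Kleitman's lemma `card_inter_refl_le` applies in the whole cube. [this work] -/
theorem card_principal_inter_refl_le (m : Finset γ) {A B : Finset (Finset γ)}
    (hA : IsUpperSet (A : Set (Finset γ))) (hB : IsUpperSet (B : Set (Finset γ))) :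
    (univ.filter (fun t : Finset γ => m ⊆ t) ∩ A ∩ refl B).card ≤ ((univ.filter (fun t : Finset γ => m ⊆ t)).filter (fun t => t ∈ A ∧ t \ m ∈ B)).card := by
  set B' : Finset (Finset γ) := univ.filter (fun t => t \ m ∈ B) with hB'def
  have hB' : IsUpperSet (B' : Set (Finset γ)) := by
    intro s t hst hs
    rw [mem_coe, hB'def, mem_filter] at hs ⊢
    exact ⟨mem_univ _, hB (sdiff_subset_sdiff hst (Subset.refl m)) hs.2⟩
  have hPA : IsUpperSet ((univ.filter (fun t : Finset γ => m ⊆ t) ∩ A : Finset (Finset γ)) : Set (Finset γ)) := by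
    rw [coe_inter]; exact (isUpperSet_principal m).inter hA
  have e1 : univ.filter (fun t : Finset γ => m ⊆ t) ∩ A ∩ refl B = (univ.filter (fun t : Finset γ => m ⊆ t) ∩ A) ∩ refl B' := by
    ext t
    simp only [mem_inter, mem_refl, hB'def, mem_filter, mem_univ, true_and]
    constructor
    · rintro ⟨⟨hm, ha⟩, hb⟩
      exact ⟨⟨hm, ha⟩, by rwa [compl_sdiff_eq_of_subset hm]⟩
    · rintro ⟨⟨hm, ha⟩, hb⟩
      exact ⟨⟨hm, ha⟩, by rwa [compl_sdiff_eq_of_subset hm] at hb⟩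
  have e2 : (univ.filter (fun t : Finset γ => m ⊆ t)).filter (fun t => t ∈ A ∧ t \ m ∈ B) = (univ.filter (fun t : Finset γ => m ⊆ t) ∩ A) ∩ B' := by
    ext t
    simp only [mem_filter, mem_inter, hB'def, mem_univ, true_and]
    tauto
  rw [e1, e2]
  exact card_inter_refl_le hPA hB'

/-! ### The interval antipode of a face -/

/-- **The interval antipode.**  `t ↦ m ∪ tᶜ` is an involution of the face `{t | m ⊆ t}` exchanging `tᶜ` and `t \ m`; hence for any
families `A, B`: `#{t ⊇ m : tᶜ ∈ A, tᶜ ∈ B} = #{t ⊇ m : t \ m ∈ A, t \ m ∈ B}`. [this work] -/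
theorem card_principal_inter_refl_refl (m : Finset γ) (A B : Finset (Finset γ)) :
    (univ.filter (fun t : Finset γ => m ⊆ t) ∩ refl A ∩ refl B).card = ((univ.filter (fun t : Finset γ => m ⊆ t)).filter (fun t => t \ m ∈ A ∧ t \ m ∈ B)).card := by
  refine Finset.card_bij (fun t _ => m ∪ tᶜ) ?_ ?_ ?_
  · intro t ht
    simp only [mem_inter, mem_principal, mem_refl] at ht
    obtain ⟨⟨hm, ha⟩, hb⟩ := ht
    have hs : (m ∪ tᶜ) \ m = tᶜ := by
      rw [union_sdiff_left, compl_sdiff_eq_of_subset hm]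
    simp only [mem_filter, mem_univ, true_and, hs]
    exact ⟨subset_union_left, ha, hb⟩
  · intro t₁ ht₁ t₂ ht₂ h
    simp only [mem_inter, mem_principal] at ht₁ ht₂
    have h1 : (m ∪ t₁ᶜ) \ m = t₁ᶜ := by rw [union_sdiff_left, compl_sdiff_eq_of_subset ht₁.1.1]
    have h2 : (m ∪ t₂ᶜ) \ m = t₂ᶜ := by rw [union_sdiff_left, compl_sdiff_eq_of_subset ht₂.1.1]
    have : t₁ᶜ = t₂ᶜ := by rw [← h1, ← h2, h]
    exact compl_injective this
  · intro u hu
    simp only [mem_filter, mem_univ, true_and] at hu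
    obtain ⟨hm, ha, hb⟩ := hu
    refine ⟨(u \ m)ᶜ, ?_, ?_⟩
    · simp only [mem_inter, mem_principal, mem_refl, compl_compl]
      refine ⟨⟨?_, ha⟩, hb⟩
      intro i hi
      rw [mem_compl, mem_sdiff, not_and, not_not]
      exact fun _ => hi
    · show m ∪ (u \ m)ᶜᶜ = u
      rw [compl_compl, union_sdiff_of_subset hm]

/-! ### The pointwise inequality in the index cube -/

/-- **Pointwise inequality in the index cube.**  For up-sets `q ⊆ f`, `h ⊆ g` of the index cube:
`0 ≤ 2#(f ∩ g) + #(q ∩ refl h) − #(f ∩ refl h) − #(q ∩ refl g) − #(q ∩ h)`.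
Proof: `#(q ∩ refl g) ≤ #(q ∩ refl h) + #(f ∩ (refl g \ refl h))`, `#(f ∩ refl h) + #(f ∩ (refl g \ refl h)) = #(f ∩ refl g) ≤ #(f ∩ g)` (Kleitman)
and `#(q ∩ h) ≤ #(f ∩ g)`. [this work] -/
theorem principal_pointwise_nonneg (f g q h : Finset (Finset β))
    (hf : IsUpperSet (f : Set (Finset β))) (hg : IsUpperSet (g : Set (Finset β))) (hq : q ⊆ f) (hh : h ⊆ g) :
    0 ≤ 2 * ((f ∩ g).card : ℤ) + (q ∩ refl h).card - (f ∩ refl h).card - (q ∩ refl g).card - (q ∩ h).card := by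
  have hrefl : refl h ⊆ refl g := by
    intro x hx
    rw [mem_refl] at hx ⊢
    exact hh hx
  have s1 : (q ∩ refl g).card ≤ (q ∩ refl h).card + (f ∩ (refl g \ refl h)).card := by
    have hsub : q ∩ refl g ⊆ (q ∩ refl h) ∪ (f ∩ (refl g \ refl h)) := by
      intro x hx
      rw [mem_inter] at hx
      rw [mem_union, mem_inter, mem_inter, mem_sdiff]
      by_cases hxh : x ∈ refl h
      · exact Or.inl ⟨hx.1, hxh⟩
      · exact Or.inr ⟨hq hx.1, hx.2, hxh⟩
    exact (card_le_card hsub).trans (card_union_le _ _)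
  have s2 : (f ∩ refl h).card + (f ∩ (refl g \ refl h)).card = (f ∩ refl g).card := by
    have e : f ∩ refl g = (f ∩ refl h) ∪ (f ∩ (refl g \ refl h)) := by
      ext x
      simp only [mem_inter, mem_union, mem_sdiff]
      constructor
      · rintro ⟨hxf, hxg⟩
        by_cases hxh : x ∈ refl h
        · exact Or.inl ⟨hxf, hxh⟩
        · exact Or.inr ⟨hxf, hxg, hxh⟩
      · rintro (⟨hxf, hxh⟩ | ⟨hxf, hxg, -⟩)
        · exact ⟨hxf, hrefl hxh⟩
        · exact ⟨hxf, hxg⟩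
    have d : Disjoint (f ∩ refl h) (f ∩ (refl g \ refl h)) := by
      rw [disjoint_left]
      intro x hx hx'
      rw [mem_inter] at hx
      rw [mem_inter, mem_sdiff] at hx'
      exact hx'.2.2 hx.2
    rw [e, card_union_of_disjoint d]
  have s3 : (f ∩ refl g).card ≤ (f ∩ g).card := card_inter_refl_le hf hg
  have s4 : (q ∩ h).card ≤ (f ∩ g).card := card_le_card (inter_subset_inter hq hh)
  omega

/-! ### Double counting -/

omit [DecidableEq β] [DecidableEq γ] [Fintype γ] in
/-- Double counting of a relation between indices and points: `Σ_x #{t ∈ P | p x t} = Σ_{t ∈ P} #{x | p x t}`. [this work] -/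
theorem sum_card_filter_comm (P : Finset (Finset γ)) (p : Finset β → Finset γ → Prop) [∀ x t, Decidable (p x t)] :
    ∑ x : Finset β, ((P.filter (fun t => p x t)).card : ℤ) = ∑ t ∈ P, ((univ.filter (fun x => p x t)).card : ℤ) := by
  have h1 : ∀ x : Finset β, ((P.filter (fun t => p x t)).card : ℤ) = ∑ t ∈ P, (if p x t then (1 : ℤ) else 0) := by
    intro x
    rw [Finset.sum_boole]
  have h2 : ∀ t : Finset γ, ((univ.filter (fun x => p x t)).card : ℤ) = ∑ x : Finset β, (if p x t then (1 : ℤ) else 0) := by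
    intro t
    rw [Finset.sum_boole]
  simp only [h1, h2]
  exact Finset.sum_comm

/-! ### The theorem -/

/-- The per-index lower bound on a face: for `P = {t | m ⊆ t}` and up-sets `F x`, `G x`,
`triWTerm P F G x ≥ 2#(P ∩ F x ∩ G x) − #{t∈P | t ∈ G xᶜ, t\m ∈ F x} − #{t∈P | t ∈ F x, t\m ∈ G xᶜ} − #{t∈P | t\m ∈ F x ∩ G x} + #{t∈P | t\m ∈ F x, t \ m ∈ G xᶜ}`
(two relative Kleitman lemmas and two interval antipodes). [this work] -/
theorem triWTerm_principal_ge (m : Finset γ) (F G : Finset β → Finset (Finset γ))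
    (hF : ∀ x, IsUpperSet (F x : Set (Finset γ))) (hG : ∀ x, IsUpperSet (G x : Set (Finset γ))) (x : Finset β) :
    2 * ((univ.filter (fun t : Finset γ => m ⊆ t) ∩ F x ∩ G x).card : ℤ)
        - ((univ.filter (fun t : Finset γ => m ⊆ t)).filter (fun t => t ∈ G xᶜ ∧ t \ m ∈ F x)).card
        - ((univ.filter (fun t : Finset γ => m ⊆ t)).filter (fun t => t ∈ F x ∧ t \ m ∈ G xᶜ)).card
        - ((univ.filter (fun t : Finset γ => m ⊆ t)).filter (fun t => t \ m ∈ F x ∧ t \ m ∈ G x)).card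
        + ((univ.filter (fun t : Finset γ => m ⊆ t)).filter (fun t => t \ m ∈ F x ∧ t \ m ∈ G xᶜ)).card
      ≤ triWTerm (univ.filter (fun t : Finset γ => m ⊆ t)) F G x := by
  unfold triWTerm
  have h1 : (univ.filter (fun t : Finset γ => m ⊆ t) ∩ refl (F x) ∩ G xᶜ).card ≤ ((univ.filter (fun t : Finset γ => m ⊆ t)).filter (fun t => t ∈ G xᶜ ∧ t \ m ∈ F x)).card := by
    rw [inter_assoc, inter_comm (refl (F x)), ← inter_assoc]
    exact card_principal_inter_refl_le m (hG xᶜ) (hF x)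
  have h2 : (univ.filter (fun t : Finset γ => m ⊆ t) ∩ F x ∩ refl (G xᶜ)).card ≤ ((univ.filter (fun t : Finset γ => m ⊆ t)).filter (fun t => t ∈ F x ∧ t \ m ∈ G xᶜ)).card :=
    card_principal_inter_refl_le m (hF x) (hG xᶜ)
  have h3 : (univ.filter (fun t : Finset γ => m ⊆ t) ∩ refl (F x) ∩ refl (G x)).card = ((univ.filter (fun t : Finset γ => m ⊆ t)).filter (fun t => t \ m ∈ F x ∧ t \ m ∈ G x)).card :=
    card_principal_inter_refl_refl m (F x) (G x)
  have h4 : (univ.filter (fun t : Finset γ => m ⊆ t) ∩ refl (F x) ∩ refl (G xᶜ)).card = ((univ.filter (fun t : Finset γ => m ⊆ t)).filter (fun t => t \ m ∈ F x ∧ t \ m ∈ G xᶜ)).card :=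
    card_principal_inter_refl_refl m (F x) (G xᶜ)
  omega

/-- **`TRI_W(a) ≥ 0` on every principal up-set.**  For every index cube `Finset β`, every cube `Finset γ`, every `m : Finset γ` and all
MONOTONE families `F, G` of UP-SETS: `0 ≤ triW (univ.filter (fun t : Finset γ => m ⊆ t)) F G`.  (A stratum of `FiveUpSet.TriWIneq` defined by a condition on `P` alone;
for `m = ∅` it is `triW_univ_nonneg`.) [this work] -/
theorem triW_nonneg_of_principal (m : Finset γ) (F G : Finset β → Finset (Finset γ))
    (hF : ∀ x, IsUpperSet (F x : Set (Finset γ))) (hG : ∀ x, IsUpperSet (G x : Set (Finset γ)))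
    (hFm : Monotone F) (hGm : Monotone G) : 0 ≤ triW (univ.filter (fun t : Finset γ => m ⊆ t)) F G := by
  set P : Finset (Finset γ) := univ.filter (fun t : Finset γ => m ⊆ t) with hPdef
  -- Step 1: the per-index lower bounds, summed
  have hsum : ∑ x : Finset β, (2 * ((P ∩ F x ∩ G x).card : ℤ)
        - ((P.filter (fun t => t ∈ G xᶜ ∧ t \ m ∈ F x)).card : ℤ)
        - ((P.filter (fun t => t ∈ F x ∧ t \ m ∈ G xᶜ)).card : ℤ)
        - ((P.filter (fun t => t \ m ∈ F x ∧ t \ m ∈ G x)).card : ℤ)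
        + ((P.filter (fun t => t \ m ∈ F x ∧ t \ m ∈ G xᶜ)).card : ℤ)) ≤ triW P F G := by
    unfold triW
    exact sum_le_sum fun x _ => triWTerm_principal_ge m F G hF hG x
  -- Step 2: double counting, index ↔ point
  have d0 : ∑ x : Finset β, ((P ∩ F x ∩ G x).card : ℤ) = ∑ t ∈ P, ((idxSet F t ∩ idxSet G t).card : ℤ) :=
    (sum_card_idxSet_inter P F G).symm
  have d1 : ∑ x : Finset β, ((P.filter (fun t => t ∈ G xᶜ ∧ t \ m ∈ F x)).card : ℤ)
      = ∑ t ∈ P, ((idxSet F (t \ m) ∩ refl (idxSet G t)).card : ℤ) := by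
    rw [sum_card_filter_comm P (fun x t => t ∈ G xᶜ ∧ t \ m ∈ F x)]
    refine sum_congr rfl fun t _ => ?_
    congr 2
    ext x; simp only [mem_filter, mem_univ, true_and, mem_inter, mem_idxSet, mem_refl_idxSet]; tauto
  have d2 : ∑ x : Finset β, ((P.filter (fun t => t ∈ F x ∧ t \ m ∈ G xᶜ)).card : ℤ)
      = ∑ t ∈ P, ((idxSet F t ∩ refl (idxSet G (t \ m))).card : ℤ) := by
    rw [sum_card_filter_comm P (fun x t => t ∈ F x ∧ t \ m ∈ G xᶜ)]
    refine sum_congr rfl fun t _ => ?_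
    congr 2
    ext x; simp only [mem_filter, mem_univ, true_and, mem_inter, mem_idxSet, mem_refl_idxSet]
  have d3 : ∑ x : Finset β, ((P.filter (fun t => t \ m ∈ F x ∧ t \ m ∈ G x)).card : ℤ)
      = ∑ t ∈ P, ((idxSet F (t \ m) ∩ idxSet G (t \ m)).card : ℤ) := by
    rw [sum_card_filter_comm P (fun x t => t \ m ∈ F x ∧ t \ m ∈ G x)]
    refine sum_congr rfl fun t _ => ?_
    congr 2
    ext x; simp only [mem_filter, mem_univ, true_and, mem_inter, mem_idxSet]
  have d4 : ∑ x : Finset β, ((P.filter (fun t => t \ m ∈ F x ∧ t \ m ∈ G xᶜ)).card : ℤ)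
      = ∑ t ∈ P, ((idxSet F (t \ m) ∩ refl (idxSet G (t \ m))).card : ℤ) := by
    rw [sum_card_filter_comm P (fun x t => t \ m ∈ F x ∧ t \ m ∈ G xᶜ)]
    refine sum_congr rfl fun t _ => ?_
    congr 2
    ext x; simp only [mem_filter, mem_univ, true_and, mem_inter, mem_idxSet, mem_refl_idxSet]
  -- Step 3: pointwise non-negativity
  have hpt : ∀ t ∈ P, 0 ≤ 2 * ((idxSet F t ∩ idxSet G t).card : ℤ) + (idxSet F (t \ m) ∩ refl (idxSet G (t \ m))).card
      - (idxSet F t ∩ refl (idxSet G (t \ m))).card - (idxSet F (t \ m) ∩ refl (idxSet G t)).card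
      - (idxSet F (t \ m) ∩ idxSet G (t \ m)).card := by
    intro t _
    refine principal_pointwise_nonneg (idxSet F t) (idxSet G t) (idxSet F (t \ m)) (idxSet G (t \ m))
      (isUpperSet_idxSet hFm t) (isUpperSet_idxSet hGm t) ?_ ?_
    · intro x hx
      rw [mem_idxSet] at hx ⊢
      exact hF x sdiff_subset hx
    · intro x hx
      rw [mem_idxSet] at hx ⊢
      exact hG x sdiff_subset hx
  have hlow : 0 ≤ ∑ x : Finset β, (2 * ((P ∩ F x ∩ G x).card : ℤ)
        - ((P.filter (fun t => t ∈ G xᶜ ∧ t \ m ∈ F x)).card : ℤ)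
        - ((P.filter (fun t => t ∈ F x ∧ t \ m ∈ G xᶜ)).card : ℤ)
        - ((P.filter (fun t => t \ m ∈ F x ∧ t \ m ∈ G x)).card : ℤ)
        + ((P.filter (fun t => t \ m ∈ F x ∧ t \ m ∈ G xᶜ)).card : ℤ)) := by
    rw [sum_add_distrib, sum_sub_distrib, sum_sub_distrib, sum_sub_distrib, ← Finset.mul_sum, d0, d1, d2, d3, d4,
      Finset.mul_sum, ← sum_sub_distrib, ← sum_sub_distrib, ← sum_sub_distrib, ← sum_add_distrib]
    refine sum_nonneg fun t ht => ?_
    have := hpt t ht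
    linarith
  linarith

end FiveUpSet

end Summit.CriticalPhenomena.PercolationContinuityZ3.Theorems
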